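import Summits.PneNP.PneNP.Theorems.ConvexRankGatesCliqueExtLowerBoundAndPad
import Summits.PneNP.PneNP.Theorems.ConvexRankGatesCliqueExtLowerBoundGRankAndPad

/-!
# Wideness is free, GRANK leaf: the r7 GRANK leaf (all levels) implies the r8 GRANK leaf
(crux `ConvexRankGates.CliqueExtLowerBound`, stmt-PneNP-10682; line `width-threshold-certificate-sparsity`,
reshape r8 of lead c12, registered sub-goal `grankCnfAll_of_grankCnf`; `--supports stmt-PneNP-10682`)

The r7 GRANK leaf `stub_grankCnf` excludes the NARROW gates (PERM or GRANK of width `≤ T = ⌊m^{1/16}⌋₊`);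
the r8 GRANK leaf `stub_grankCnfAll` has no side condition. The exclusion is idle: given a GRANK gate `φ` of
size parameter `≤ m^c` and `s`-local children `C`, pad `φ` with `n' := T (log₂ T + 1) + 1` dummy wires,
`pad := ⟨φ.1 + n', v ↦ φ.2 (v ∘ castAdd) && [∀ j, v (natAdd φ.1 j)]⟩` (written inline, no definition), and feed the
dummies with the EMPTY (constant-true) CNF. Then
* `pad` is a GRANK gate of size parameter `m^c + (m^c + 1) n' ≤ m^{c+1}` (landed `GRankAndPad.isGRankGate_andPad`,
  `AndPad.eventually_pad_numerics`);
* if `φ` accepts something, `pad` is NOT narrow (landed `AndPad.not_narrow_andPad`);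
* the padded children are `s`-local with at most one more distinct member (`AndPad.andPad_local`,
  `AndPad.card_image_andPad_le`), and the composed Boolean function of the edges is unchanged (`AndPad.andPad_cval`).
So the r7 leaf at level `c + 1` delivers a legal `(r, s)`-local sandwich of the SAME function with the better error
factor `1/(8 m^{c+2}) ≤ 1/(8 m^{c+1})`. If `φ` accepts nothing, the empty DNF and the CNF `{∅}` (one empty clause)
sandwich it with no error at all. Everything here is bookkeeping. [folklore]
-/

-- summit and problem are both named `PneNP`, so every declaration lives in `Summit.PneNP.PneNP.…`
set_option linter.dupNamespace false

open Literature.Computability.Complexity Filter Finset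

namespace Summit.PneNP.PneNP.Theorems.CliqueExtLowerBound.WidthThreshold.GRankPadLeaf

open Summit.PneNP.PneNP.Theorems.CliqueExtLowerBound.WidthThreshold.AndPad
  (andPad_cval card_image_andPad_le andPad_local not_narrow_andPad eventually_pad_numerics)
open Summit.PneNP.PneNP.Theorems.CliqueExtLowerBound.WidthThreshold.GRankAndPad (isGRankGate_andPad)

/-! ## §1 Bookkeeping: the error factor and the constant-false gate -/

/-- The error factor only improves with the level: `1/(8 m^{c+2}) ≤ 1/(8 m^{c+1})` once `m ≥ 1`. [folklore] -/
theorem errFactor_le {m : ℕ} (c : ℕ) (hm : 1 ≤ m) :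
    1 / (8 * (m : ℝ) ^ (c + 1 + 1)) ≤ 1 / (8 * (m : ℝ) ^ (c + 1)) := by
  have hm0 : (1 : ℝ) ≤ m := by exact_mod_cast hm
  refine one_div_le_one_div_of_le (by positivity) ?_
  exact mul_le_mul_of_nonneg_left (pow_le_pow_right₀ hm0 (by omega)) (by norm_num)

open Classical in
/-- A Boolean function `g` of the inputs that never accepts is sandwiched with NO error by the empty DNF
(constant false) below and the CNF `{∅}` with one empty clause (constant false) above: on any family `P` of
positives nothing is accepted-but-missed, on any family `N` of negatives nothing passes the CNF. [folklore] -/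
theorem sandwich_of_forall_eq_false {ι : Type} (P N : Finset (ι → Bool)) (g : (ι → Bool) → Bool)
    (hg : ∀ x, g x = false) (r s : ℕ) {ε : ℝ} (hε : 0 ≤ ε) :
    ∃ dnf cnf : Finset (Finset ι),
      (∀ R ∈ dnf, #R ≤ r - 1) ∧ (∀ S ∈ cnf, #S ≤ s - 1) ∧
      (∀ x, EvalDNF dnf x → EvalCNF cnf x) ∧
      (#(P.filter (fun x => g x = true ∧ ¬ EvalDNF dnf x)) : ℝ) ≤ ε * #P ∧
      (#(N.filter (fun x => EvalCNF cnf x ∧ g x = false)) : ℝ) ≤ ε * #N := by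
  refine ⟨∅, {∅}, by simp, by simp, fun x hx => ?_, ?_, ?_⟩
  · obtain ⟨R, hR, -⟩ := hx
    simp at hR
  · rw [filter_false_of_mem, card_empty, Nat.cast_zero]
    · exact mul_nonneg hε (Nat.cast_nonneg _)
    · rintro x - ⟨hx, -⟩
      rw [hg x] at hx
      exact Bool.false_ne_true hx
  · rw [filter_false_of_mem, card_empty, Nat.cast_zero]
    · exact mul_nonneg hε (Nat.cast_nonneg _)
    · rintro x - ⟨hx, -⟩
      obtain ⟨i, hi, -⟩ := hx ∅ (mem_singleton_self _)
      simp at hi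

/-! ## §2 The registered sub-goal: the r7 GRANK leaf (all levels) implies the r8 GRANK leaf (all levels) -/

open Classical in
/-- **Wideness is free (GRANK)** (registered sub-goal `grankCnfAll_of_grankCnf` of the line
`width-threshold-certificate-sparsity`, reshape r8): the r7 GRANK leaf text (GRANK gates of size parameter `≤ m^c`
that are NOT narrow, all levels `c`) implies the r8 GRANK leaf text (every GRANK gate of size parameter `≤ m^c`,
all levels `c`). Given `φ` and children `C` at level `c`: if `φ` accepts nothing, `(∅, {∅})` is an error-free
sandwich (`sandwich_of_forall_eq_false`); otherwise pad `φ` with `n' = T(log₂ T + 1) + 1` dummy wires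
(`T = ⌊m^{1/16}⌋₊`) fed by the empty CNF — a GRANK gate of size parameter `≤ m^{c+1}` (`isGRankGate_andPad`,
`eventually_pad_numerics`), not narrow (`not_narrow_andPad`), with `s`-local children of `≤ m^{c+3} + 1 ≤ m^{c+4}`
distinct members (`andPad_local`, `card_image_andPad_le`) and the same composed function (`andPad_cval`) — and
apply the r7 leaf at level `c + 1`, whose error factor `1/(8 m^{c+2})` is below `1/(8 m^{c+1})`. [folklore] -/
theorem grankCnfAll_of_grankCnf :
    (∀ c : ℕ, ∃ r₀ s₀ : ℕ, 2 ≤ r₀ ∧ 2 ≤ s₀ ∧ ∀ r s : ℕ, r₀ ≤ r → s₀ ≤ s →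
    ∀ᶠ m : ℕ in atTop, ∀ φ : GateFn, IsGRankGate (m ^ c) φ →
      ¬ (IsPermGate ⌊(m : ℝ) ^ (1 / 16 : ℝ)⌋₊ φ ∨ IsGRankGate ⌊(m : ℝ) ^ (1 / 16 : ℝ)⌋₊ φ) →
      ∀ C : Fin φ.1 → Finset (Finset ((⊤ : SimpleGraph (Fin m)).edgeSet)),
        #(univ.image C) ≤ m ^ (c + 3) → (∀ j, ∀ S ∈ C j, #S ≤ s - 1) →
        ∃ dnf cnf : Finset (Finset ((⊤ : SimpleGraph (Fin m)).edgeSet)),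
          (∀ R ∈ dnf, #R ≤ r - 1) ∧ (∀ S ∈ cnf, #S ≤ s - 1) ∧
          (∀ x, EvalDNF dnf x → EvalCNF cnf x) ∧
          (#((posGraphs m ⌈(m : ℝ) ^ (1 / 4 : ℝ)⌉₊).filter
              (fun x => φ.2 (fun j => decide (EvalCNF (C j) x)) = true ∧ ¬ EvalDNF dnf x)) : ℝ)
            ≤ (1 / (8 * (m : ℝ) ^ (c + 1))) * #(posGraphs m ⌈(m : ℝ) ^ (1 / 4 : ℝ)⌉₊) ∧
          (#((((powersetCard (Fintype.card ((⊤ : SimpleGraph (Fin m)).edgeSet) / ⌊(m : ℝ) ^ (1 / 8 : ℝ)⌋₊)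
          (univ : Finset ((⊤ : SimpleGraph (Fin m)).edgeSet))).image (fun M => fun e => decide (e ∉ M)))).filter
              (fun x => EvalCNF cnf x ∧ φ.2 (fun j => decide (EvalCNF (C j) x)) = false)) : ℝ)
            ≤ (1 / (8 * (m : ℝ) ^ (c + 1))) *
              #(((powersetCard (Fintype.card ((⊤ : SimpleGraph (Fin m)).edgeSet) / ⌊(m : ℝ) ^ (1 / 8 : ℝ)⌋₊)
          (univ : Finset ((⊤ : SimpleGraph (Fin m)).edgeSet))).image (fun M => fun e => decide (e ∉ M))))) →
    (∀ c : ℕ, ∃ r₀ s₀ : ℕ, 2 ≤ r₀ ∧ 2 ≤ s₀ ∧ ∀ r s : ℕ, r₀ ≤ r → s₀ ≤ s →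
    ∀ᶠ m : ℕ in atTop, ∀ φ : GateFn, IsGRankGate (m ^ c) φ →
      ∀ C : Fin φ.1 → Finset (Finset ((⊤ : SimpleGraph (Fin m)).edgeSet)),
        #(univ.image C) ≤ m ^ (c + 3) → (∀ j, ∀ S ∈ C j, #S ≤ s - 1) →
        ∃ dnf cnf : Finset (Finset ((⊤ : SimpleGraph (Fin m)).edgeSet)),
          (∀ R ∈ dnf, #R ≤ r - 1) ∧ (∀ S ∈ cnf, #S ≤ s - 1) ∧
          (∀ x, EvalDNF dnf x → EvalCNF cnf x) ∧
          (#((posGraphs m ⌈(m : ℝ) ^ (1 / 4 : ℝ)⌉₊).filter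
              (fun x => φ.2 (fun j => decide (EvalCNF (C j) x)) = true ∧ ¬ EvalDNF dnf x)) : ℝ)
            ≤ (1 / (8 * (m : ℝ) ^ (c + 1))) * #(posGraphs m ⌈(m : ℝ) ^ (1 / 4 : ℝ)⌉₊) ∧
          (#((((powersetCard (Fintype.card ((⊤ : SimpleGraph (Fin m)).edgeSet) / ⌊(m : ℝ) ^ (1 / 8 : ℝ)⌋₊)
          (univ : Finset ((⊤ : SimpleGraph (Fin m)).edgeSet))).image (fun M => fun e => decide (e ∉ M)))).filter
              (fun x => EvalCNF cnf x ∧ φ.2 (fun j => decide (EvalCNF (C j) x)) = false)) : ℝ)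
            ≤ (1 / (8 * (m : ℝ) ^ (c + 1))) *
              #(((powersetCard (Fintype.card ((⊤ : SimpleGraph (Fin m)).edgeSet) / ⌊(m : ℝ) ^ (1 / 8 : ℝ)⌋₊)
          (univ : Finset ((⊤ : SimpleGraph (Fin m)).edgeSet))).image (fun M => fun e => decide (e ∉ M))))) := by
  intro h c
  obtain ⟨r₀, s₀, hr₀, hs₀, H⟩ := h (c + 1)
  refine ⟨r₀, s₀, hr₀, hs₀, fun r s hr hs => ?_⟩
  filter_upwards [H r s hr hs, eventually_pad_numerics c, eventually_ge_atTop 1] with m hm hnum hm1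
  intro φ hφ C hC hCs
  obtain ⟨-, hnum2, -, hnum4, -⟩ := hnum
  have herr : 1 / (8 * (m : ℝ) ^ (c + 1 + 1)) ≤ 1 / (8 * (m : ℝ) ^ (c + 1)) := errFactor_le c hm1
  by_cases hacc : ∃ v, φ.2 v = true
  · -- CASE A: `φ` accepts something — pad it and apply the r7 leaf at level `c + 1`
    set T : ℕ := ⌊(m : ℝ) ^ (1 / 16 : ℝ)⌋₊
    set n' : ℕ := T * (Nat.log 2 T + 1) + 1
    -- transfer: ANY level-`c+1` gate `ψ` with children `C'` computing the same function of the edges will do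
    have key : ∀ (ψ : GateFn) (C' : Fin ψ.1 → Finset (Finset ((⊤ : SimpleGraph (Fin m)).edgeSet))),
        IsGRankGate (m ^ (c + 1)) ψ → ¬ (IsPermGate T ψ ∨ IsGRankGate T ψ) →
        #(univ.image C') ≤ m ^ (c + 1 + 3) → (∀ j, ∀ S ∈ C' j, #S ≤ s - 1) →
        (∀ x, ψ.2 (fun j => decide (EvalCNF (C' j) x)) = φ.2 (fun j => decide (EvalCNF (C j) x))) →
        ∃ dnf cnf : Finset (Finset ((⊤ : SimpleGraph (Fin m)).edgeSet)),
          (∀ R ∈ dnf, #R ≤ r - 1) ∧ (∀ S ∈ cnf, #S ≤ s - 1) ∧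
          (∀ x, EvalDNF dnf x → EvalCNF cnf x) ∧
          (#((posGraphs m ⌈(m : ℝ) ^ (1 / 4 : ℝ)⌉₊).filter
              (fun x => φ.2 (fun j => decide (EvalCNF (C j) x)) = true ∧ ¬ EvalDNF dnf x)) : ℝ)
            ≤ (1 / (8 * (m : ℝ) ^ (c + 1))) * #(posGraphs m ⌈(m : ℝ) ^ (1 / 4 : ℝ)⌉₊) ∧
          (#((((powersetCard (Fintype.card ((⊤ : SimpleGraph (Fin m)).edgeSet) / ⌊(m : ℝ) ^ (1 / 8 : ℝ)⌋₊)
          (univ : Finset ((⊤ : SimpleGraph (Fin m)).edgeSet))).image (fun M => fun e => decide (e ∉ M)))).filter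
              (fun x => EvalCNF cnf x ∧ φ.2 (fun j => decide (EvalCNF (C j) x)) = false)) : ℝ)
            ≤ (1 / (8 * (m : ℝ) ^ (c + 1))) *
              #(((powersetCard (Fintype.card ((⊤ : SimpleGraph (Fin m)).edgeSet) / ⌊(m : ℝ) ^ (1 / 8 : ℝ)⌋₊)
          (univ : Finset ((⊤ : SimpleGraph (Fin m)).edgeSet))).image (fun M => fun e => decide (e ∉ M)))) := by
      intro ψ C' hψ hnn hC' hloc' hfun
      obtain ⟨dnf, cnf, h1, h2, h3, h4, h5⟩ := hm ψ hψ hnn C' hC' hloc'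
      simp only [hfun] at h4 h5
      exact ⟨dnf, cnf, h1, h2, h3, h4.trans (mul_le_mul_of_nonneg_right herr (Nat.cast_nonneg _)),
        h5.trans (mul_le_mul_of_nonneg_right herr (Nat.cast_nonneg _))⟩
    exact key ⟨φ.1 + n', fun v => φ.2 (fun i => v (Fin.castAdd n' i)) &&
        decide (∀ j : Fin n', v (Fin.natAdd φ.1 j) = true)⟩
      (Fin.addCases (motive := fun _ => Finset (Finset ((⊤ : SimpleGraph (Fin m)).edgeSet))) C
        (fun _ : Fin n' => (∅ : Finset (Finset ((⊤ : SimpleGraph (Fin m)).edgeSet)))))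
      ((isGRankGate_andPad (m ^ c) n' φ hφ).mono hnum2)
      (not_narrow_andPad T n' φ hacc (Nat.lt_add_one _))
      ((card_image_andPad_le φ n' C).trans ((Nat.add_le_add_right hC 1).trans hnum4))
      (andPad_local φ n' s C hCs)
      (fun x => andPad_cval φ n' C x)
  · -- CASE B: `φ` accepts nothing — the error-free sandwich `(∅, {∅})`
    exact sandwich_of_forall_eq_false _ _ (fun x => φ.2 (fun j => decide (EvalCNF (C j) x)))
      (fun x => eq_false_of_ne_true (not_exists.1 hacc _)) r s (by positivity)

end Summit.PneNP.PneNP.Theorems.CliqueExtLowerBound.WidthThreshold.GRankPadLeaf
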